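import Mathlib
import Literature.Computability.AlgebraicComplexity.MignonRessayreBound
import Summits.MatrixMultiplication.MatrixMultiplication.Theorems.SnSubsetDichotomyPolynomialSlackStubSplit

/-!
# `SnSubsetDichotomy.PolynomialSlack`, line `transport-split-hull` — the two-entry cap

Crux `Summit.MatrixMultiplication.MatrixMultiplication.Theses.SnSubsetDichotomy.PolynomialSlack`
(item `stmt-MatrixMultiplication-8306`), level-one programme on triples `S, T, U ⊆ S_n` with the
triple product property, lead c5, line `transport-split-hull`: the registered stubs
`card_perm_apply_two_eq` and `card_filter_quot_apply_two_mem_le` (TWO-ENTRY CAP).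

The ENTRY CAP says that the pair quotient set `B = T⁻¹U`, which is injectively parametrised by
`T × U` (tree lemma `injOn_quot_second`), has at most `(n-1)!` elements in any point cylinder
`{g : g k = a}`.  This file proves the two-point version ("double hits at two hub positions cost `n²`
in co-density"):

* `card_perm_apply_two_eq` — for positions `k₁ ≠ k₂` and values `a ≠ b` exactly `(n-2)!`
  permutations `g` of `Fin n` have `g k₁ = a` and `g k₂ = b` (the tree's count of permutations with
  two prescribed values, `Literature.Computability.AlgebraicComplexity.card_perm_apply_eq_two`,
  read through `Fintype.card_subtype`);
* `card_perm_apply_two_le` — the same cell has at most `(n-2)!` elements for ALL `a, b` (it is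
  empty when `a = b`, a permutation being injective);
* `card_perm_apply_two_mem_le` — `#{g : g k₁ ∈ X₁ ∧ g k₂ ∈ X₂} ≤ |X₁|·|X₂|·(n-2)!` (union of the
  cells over `(a, b) ∈ X₁ × X₂`);
* `card_filter_quot_apply_two_mem_le` — the TWO-ENTRY CAP: for a triple `S, T, U ⊆ S_n` with the
  triple product property and `S ≠ ∅`, the number of pairs `(t, u) ∈ T × U` with
  `(t⁻¹u) k₁ ∈ X₁` and `(t⁻¹u) k₂ ∈ X₂` is at most `|X₁|·|X₂|·(n-2)!` (the quotient map
  `(t, u) ↦ t⁻¹u` is injective on `T × U` and lands in the set of the previous item).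

Mathlib, the tree's permutation count and `injOn_quot_second` only.
-/

-- `Summit.<Summit>.<Problem>` is the tree's mandated summit-side namespace; for this
-- single-conjunct summit the two coincide, so the file silences `dupNamespace`.
set_option linter.dupNamespace false

open scoped BigOperators
open Literature.Combinatorics.Additive (TripleProductProperty)

namespace Summit.MatrixMultiplication.MatrixMultiplication.Theorems.PolynomialSlack

/-- **Two prescribed values.** For positions `k₁ ≠ k₂` and values `a ≠ b` in `Fin n`, exactly
`(n-2)!` permutations `g` of `Fin n` satisfy `g k₁ = a` and `g k₂ = b` (a translate of the
pointwise stabiliser of two points; the tree's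
`Literature.Computability.AlgebraicComplexity.card_perm_apply_eq_two`). [folklore] -/
theorem card_perm_apply_two_eq {n : ℕ} {k₁ k₂ a b : Fin n} (hk : k₁ ≠ k₂) (hab : a ≠ b) :
    (Finset.univ.filter fun g : Equiv.Perm (Fin n) => g k₁ = a ∧ g k₂ = b).card =
      (n - 2).factorial := by
  have h := Literature.Computability.AlgebraicComplexity.card_perm_apply_eq_two
    (α := Fin n) hk hab
  rw [Fintype.card_subtype, Fintype.card_fin] at h
  exact h

/-- For positions `k₁ ≠ k₂` and ANY values `a, b`, at most `(n-2)!` permutations `g` of `Fin n`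
satisfy `g k₁ = a` and `g k₂ = b`: none if `a = b` (a permutation is injective), exactly `(n-2)!`
otherwise (`card_perm_apply_two_eq`). [folklore] -/
theorem card_perm_apply_two_le {n : ℕ} {k₁ k₂ : Fin n} (hk : k₁ ≠ k₂) (a b : Fin n) :
    (Finset.univ.filter fun g : Equiv.Perm (Fin n) => g k₁ = a ∧ g k₂ = b).card ≤
      (n - 2).factorial := by
  by_cases hab : a = b
  · have he : (Finset.univ.filter fun g : Equiv.Perm (Fin n) => g k₁ = a ∧ g k₂ = b) = ∅ :=
      Finset.filter_eq_empty_iff.2 fun g _ hg =>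
        hk (g.injective (hg.1.trans (hab.trans hg.2.symm)))
    rw [he, Finset.card_empty]
    exact Nat.zero_le _
  · exact (card_perm_apply_two_eq hk hab).le

/-- **Two-point cylinder count.** For positions `k₁ ≠ k₂` and value sets `X₁, X₂ ⊆ Fin n`, at most
`|X₁|·|X₂|·(n-2)!` permutations `g` of `Fin n` have `g k₁ ∈ X₁` and `g k₂ ∈ X₂` (the set is the
union over `(a, b) ∈ X₁ × X₂` of the cells `{g : g k₁ = a ∧ g k₂ = b}`, each of size at most
`(n-2)!` by `card_perm_apply_two_le`). [folklore] -/
theorem card_perm_apply_two_mem_le {n : ℕ} {k₁ k₂ : Fin n} (hk : k₁ ≠ k₂)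
    (X₁ X₂ : Finset (Fin n)) :
    (Finset.univ.filter fun g : Equiv.Perm (Fin n) => g k₁ ∈ X₁ ∧ g k₂ ∈ X₂).card ≤
      X₁.card * X₂.card * (n - 2).factorial := by
  calc (Finset.univ.filter fun g : Equiv.Perm (Fin n) => g k₁ ∈ X₁ ∧ g k₂ ∈ X₂).card
      ≤ ((X₁ ×ˢ X₂).biUnion fun ab =>
          Finset.univ.filter fun g : Equiv.Perm (Fin n) => g k₁ = ab.1 ∧ g k₂ = ab.2).card := by
        refine Finset.card_le_card fun g hg => ?_
        rw [Finset.mem_filter] at hg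
        exact Finset.mem_biUnion.2 ⟨(g k₁, g k₂), Finset.mem_product.2 hg.2,
          Finset.mem_filter.2 ⟨Finset.mem_univ _, rfl, rfl⟩⟩
    _ ≤ ∑ ab ∈ X₁ ×ˢ X₂,
          (Finset.univ.filter fun g : Equiv.Perm (Fin n) => g k₁ = ab.1 ∧ g k₂ = ab.2).card :=
        Finset.card_biUnion_le
    _ ≤ ∑ _ab ∈ X₁ ×ˢ X₂, (n - 2).factorial :=
        Finset.sum_le_sum fun ab _ => card_perm_apply_two_le hk ab.1 ab.2
    _ = X₁.card * X₂.card * (n - 2).factorial := by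
        rw [Finset.sum_const, smul_eq_mul, Finset.card_product]

/-- **Two-entry cap for the pair quotient `T⁻¹U`.** For a triple `S, T, U ⊆ S_n` with the triple
product property and `S` non-empty, positions `k₁ ≠ k₂` and value sets `X₁, X₂`, the number of
pairs `(t, u) ∈ T × U` with `(t⁻¹u) k₁ ∈ X₁` and `(t⁻¹u) k₂ ∈ X₂` is at most `|X₁|·|X₂|·(n-2)!`:
the quotient map `(t, u) ↦ t⁻¹u` is injective on `T × U` (`injOn_quot_second`) and maps these
pairs into `{g : g k₁ ∈ X₁ ∧ g k₂ ∈ X₂}` (`card_perm_apply_two_mem_le`). [folklore] -/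
theorem card_filter_quot_apply_two_mem_le {n : ℕ} {S T U : Finset (Equiv.Perm (Fin n))}
    (h : TripleProductProperty S T U) (hS : S.Nonempty) {k₁ k₂ : Fin n} (hk : k₁ ≠ k₂)
    (X₁ X₂ : Finset (Fin n)) :
    ((T ×ˢ U).filter fun tu => (tu.1⁻¹ * tu.2) k₁ ∈ X₁ ∧ (tu.1⁻¹ * tu.2) k₂ ∈ X₂).card ≤
      X₁.card * X₂.card * (n - 2).factorial := by
  refine le_trans ?_ (card_perm_apply_two_mem_le hk X₁ X₂)
  refine Finset.card_le_card_of_injOn (fun tu => tu.1⁻¹ * tu.2) ?_ ?_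
  · intro tu htu
    exact Finset.mem_coe.2 (Finset.mem_filter.2
      ⟨Finset.mem_univ _, (Finset.mem_filter.1 (Finset.mem_coe.1 htu)).2⟩)
  · refine (injOn_quot_second h hS).mono fun tu htu => ?_
    rw [← Finset.coe_product]
    exact Finset.mem_coe.2 (Finset.mem_filter.1 (Finset.mem_coe.1 htu)).1

end Summit.MatrixMultiplication.MatrixMultiplication.Theorems.PolynomialSlack
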